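import Literature.AlgebraicGeometry.ModuliOfAbelianVarieties.Lan2013.Sec623BoundaryChartsLevelN
import HarnessLib

/-!
# [Lan2013PELCompactifications] §6.2.3 — theorem-only companion of `Lan2013/Sec623BoundaryChartsLevelN.lean` (squad RULING TS-1):
# book Lemma 6.2.3.7 (characters of `S̈^{(n)}_{Φ_n}` as alternating pairings), display (6.2.3.3) and the algebraic core of
# Lemma 6.2.3.1 (a perfect pairing determines the homomorphism `b_{Φ_n,δ_n}`) DISCHARGED

Namespace `Literature.AlgebraicGeometry.ModuliOfAbelianVarieties.Lan2013.Sec623BoundaryChartsLevelN` (same as the carpet; three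
`theorem … _holds` + private folklore helpers, no def ∕ fact ∕ sorry ∕ instance ∕ notation).  The named fact
`Lan2013_6237_charactersAsPairings` is typed as the REAL
content of book Lem. 6.2.3.7 «by the very definition of `S̈_{Φ_n}`» (p. 388): every clause follows from the relators of display (6.2.3.5)
(`sPhiRelators`) and from `S̈^{(n)}_{Φ_n}` being generated by the classes `[((1/n)y) ⊗ φ(y')] − [((1/n)y') ⊗ φ(y)]` (`sPhiGen`).
HC_CM is proved only modulo the 7 printed citations (2 remaining: hLiu418 = stmt-HodgeConjecture-24832, h413 =
stmt-HodgeConjecture-24833) until rung 0 closes; this file discharges none of them (it discharges three Literature facts, net debt −3).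
ED. 2 (T-ref3 QA3-4): + `PrincipalChartDatum.Lan2013_623_display3_holds` — display (6.2.3.3) «holds tautologically over `C̈_{Φ_n,b_n}`»
(2010 rev. p. 433) from the pin `d1_spec` and `pullback.condition`.
ED. 3 (T-ref3 (b): «CLOSED and TRUE»): + `Lan2013_6231_pairingDeterminesHom_holds` — by counting, via Mathlib's duality for finite
commutative groups (`CommGroup.card_monoidHom_of_hasEnoughRootsOfUnity`) applied to `Multiplicative A →* (Multiplicative (ZMod n))ˣ`.

## References
* [Lan2013PELCompactifications] K.-W. Lan, *Arithmetic compactifications of PEL-type Shimura varieties*, LMS Monographs 36 (2013),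
  Lem. 6.2.3.7 (p. 389; 2010 rev. Lem. 6.2.3.10, p. 436); display (6.2.3.3) (p. 387; 2010 rev. p. 433); Lem. 6.2.3.1 (p. 385;
  2010 rev. p. 430).
-/

open TensorProduct

namespace Literature.AlgebraicGeometry.ModuliOfAbelianVarieties.Lan2013.Sec623BoundaryChartsLevelN

section Relators

variable (O : Type) [Ring O] [StarRing O] {X Y : Type} [AddCommGroup X] [Module O X] [AddCommGroup Y] [Module O Y]
  (φ : Y →ₗ[O] X)

/-- Two classes of elementary tensors whose difference is a relator of (6.2.3.5) coincide in `S̈_{Φ_n}`.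
[cite: Lan2013PELCompactifications, §6.2.3 display (6.2.3.5) (p. 387)] -/
theorem SPhi.cl_eq_of_mem (n : ℕ) {y y' : Y} {χ χ' : X} (h : y ⊗ₜ[ℤ] χ - y' ⊗ₜ[ℤ] χ' ∈ sPhiRelators O φ n) :
    SPhi.cl O φ n y χ = SPhi.cl O φ n y' χ' :=
  (Submodule.Quotient.eq _).2 (Submodule.subset_span h)

/-- The first relator of (6.2.3.5): `[(n•y) ⊗ φ y'] = [(n•y') ⊗ φ y]`. [cite: Lan2013PELCompactifications, §6.2.3 display (6.2.3.5) (p. 387)] -/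
theorem SPhi.cl_nsmul_symm (n : ℕ) (y y' : Y) :
    SPhi.cl O φ n (n • y) (φ y') = SPhi.cl O φ n (n • y') (φ y) :=
  SPhi.cl_eq_of_mem O φ n (Or.inl ⟨y, y', rfl⟩)

/-- The second relator of (6.2.3.5): `[(b•y) ⊗ χ] = [y ⊗ (b⋆•χ)]`. [cite: Lan2013PELCompactifications, §6.2.3 display (6.2.3.5) (p. 387)] -/
theorem SPhi.cl_smul (n : ℕ) (b : O) (y : Y) (χ : X) :
    SPhi.cl O φ n (b • y) χ = SPhi.cl O φ n y (star b • χ) :=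
  SPhi.cl_eq_of_mem O φ n (Or.inr ⟨b, y, χ, rfl⟩)

end Relators

/-- **Book Lemma 6.2.3.7 DISCHARGED** (`Lan2013_6237_charactersAsPairings` holds): the identities follow from the relators of (6.2.3.5)
and the `𝒪`-linearity of `φ`; a character of `S̈^{(n)}_{Φ_n}` is determined on the generating classes (`AddSubgroup.closure` induction).
[cite: Lan2013PELCompactifications, Lem. 6.2.3.7 (p. 389; 2010 rev. Lem. 6.2.3.10, p. 436)] -/
theorem Lan2013_6237_charactersAsPairings_holds {O : Type} [Ring O] [StarRing O] {X Y : Type} [AddCommGroup X] [Module O X]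
    [AddCommGroup Y] [Module O Y] {φ : Y →ₗ[O] X} {n : ℕ} : Lan2013_6237_charactersAsPairings O φ n := by
  refine ⟨fun G _ g => ⟨fun y => by simp, fun y y' => map_sub g _ _, fun y y' => ?_, fun b y y' => ?_⟩, fun G _ g₁ g₂ h => ?_⟩
  · rw [SPhi.cl_nsmul_symm]
  · rw [SPhi.cl_smul, LinearMap.map_smul]
  · ext ⟨s, hs⟩
    induction hs using AddSubgroup.closure_induction with
    | mem x hx =>
      obtain ⟨y, y', rfl⟩ := hx
      exact h y y'
    | zero =>
      change g₁ 0 = g₂ 0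
      rw [map_zero, map_zero]
    | add x y hx hy ihx ihy =>
      change g₁ (⟨x, hx⟩ + ⟨y, hy⟩) = g₂ (⟨x, hx⟩ + ⟨y, hy⟩)
      rw [map_add, map_add, ihx, ihy]
    | neg x hx ihx =>
      change g₁ (-⟨x, hx⟩) = g₂ (-⟨x, hx⟩)
      rw [map_neg, map_neg, ihx]

section Display3

open CategoryTheory CategoryTheory.Limits AlgebraicGeometry

variable {O : Type} [CommRing O] [StarRing O] [Module.Free ℤ O] [Module.Finite ℤ O]
variable {L : Type} [AddCommGroup L] [Module O L] [Module.Free ℤ L] [Module.Finite ℤ L]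
variable {𝓛 : PELTypeOLattice O L} {box : Set ℕ} {n : ℕ} {𝔐 : 𝓛.FineModuliScheme box n}
variable {X Y : Type} [AddCommGroup X] [Module O X] [AddCommGroup Y] [Module O Y] {φ : Y →ₗ[O] X}

/-- **Display (6.2.3.3) DISCHARGED** (`PrincipalChartDatum.Lan2013_623_display3` holds for every datum): print's «holds tautologically over
`C̈_{Φ_n,b_n}`» — from the PIN `d1_spec` at the fibre inclusion `CfibIncl bpt` and `pullback.condition` (T-ref3 QA3-4, proof verbatim).
[cite: Lan2013PELCompactifications, §6.2.3 display (6.2.3.3) (p. 387; 2010 rev. p. 433)] -/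
theorem PrincipalChartDatum.Lan2013_623_display3_holds {𝔇 : PrincipalChartDatum 𝓛 box n 𝔐 X Y φ} :
    𝔇.Lan2013_623_display3 := by
  intro y
  have h := 𝔇.d1_spec (𝔇.CfibIncl 𝔇.bpt) y
  have hc : 𝔇.CfibIncl 𝔇.bpt ≫ 𝔇.d1 = pullback.snd 𝔇.d1 𝔇.bpt ≫ 𝔇.bpt := pullback.condition
  rw [← h, hc]
  rfl

end Display3

section PairingDeterminesHom

/-- `Multiplicative (ZMod n)` has enough `n`-th roots of unity (`n ≥ 1`): `ofAdd 1` is a primitive root and the roots of unity form a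
subgroup of the cyclic group `(Multiplicative (ZMod n))ˣ`. [folklore] -/
private theorem hasEnoughRootsOfUnity_multiplicative_zmod (n : ℕ) [NeZero n] :
    HasEnoughRootsOfUnity (Multiplicative (ZMod n)) n where
  prim := ⟨Multiplicative.ofAdd 1, by
    have h := IsPrimitiveRoot.orderOf (Multiplicative.ofAdd (1 : ZMod n))
    rwa [orderOf_ofAdd_eq_addOrderOf, ZMod.addOrderOf_one] at h⟩
  cyc := by
    haveI : IsCyclic (Multiplicative (ZMod n))ˣ :=
      isCyclic_of_surjective (toUnits (G := Multiplicative (ZMod n))) toUnits.surjective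
    infer_instance

/-- For a finite commutative group `A` killed by `n ≥ 1`: `Nat.card (A →+ ZMod n) = Nat.card A` — Mathlib's duality
`CommGroup.card_monoidHom_of_hasEnoughRootsOfUnity` for `Multiplicative A` with values in `(Multiplicative (ZMod n))ˣ`. [folklore] -/
private theorem card_addMonoidHom_zmod {A : Type} [AddCommGroup A] [Finite A] {n : ℕ} [NeZero n]
    (hA : ∀ a : A, n • a = 0) : Nat.card (A →+ ZMod n) = Nat.card A := by
  haveI := hasEnoughRootsOfUnity_multiplicative_zmod n
  have hdvd : Monoid.exponent (Multiplicative A) ∣ n :=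
    Monoid.exponent_dvd_of_forall_pow_eq_one fun g => by
      rw [← ofAdd_toAdd g, ← ofAdd_nsmul, hA, ofAdd_zero]
  haveI := HasEnoughRootsOfUnity.of_dvd (Multiplicative (ZMod n)) hdvd
  have h := CommGroup.card_monoidHom_of_hasEnoughRootsOfUnity (Multiplicative A) (Multiplicative (ZMod n))
  rw [← Nat.card_congr (AddMonoidHom.toMultiplicative.trans
    (MulEquiv.monoidHomCongrRightEquiv (toUnits (G := Multiplicative (ZMod n)))))] at h
  exact h

/-- A homomorphism from a finite commutative group to `ZMod 0 = ℤ` vanishes (`Nat.card A • x = 0` in a characteristic-zero domain). [folklore] -/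
private theorem addMonoidHom_zmod_zero_eq_zero {A : Type} [AddCommGroup A] [Finite A] (f : A →+ ZMod 0) : f = 0 := by
  ext a
  have h : Nat.card A • f a = 0 := by rw [← map_nsmul, card_nsmul_eq_zero', map_zero]
  have hc : Nat.card A ≠ 0 := Nat.card_pos.ne'
  simpa [hc] using h

/-- **Lemma 6.2.3.1 (algebraic core) DISCHARGED** (`Lan2013_6231_pairingDeterminesHom n` holds for every `n`; T-ref3: «CLOSED and TRUE»). For
finite commutative groups `A_n`, `A^∨_n` killed by `n` with a pairing `e` into `ℤ/nℤ` that is injective on both sides, COUNTING gives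
`#A^∨_n ≤ #Hom(A_n, ℤ/nℤ) = #A_n ≤ #Hom(A^∨_n, ℤ/nℤ) = #A^∨_n` (`card_addMonoidHom_zmod`), so `e.flip : A^∨_n → Hom(A_n, ℤ/nℤ)` is a
bijection and `b := (e.flip)⁻¹ ∘ p.flip` is the unique homomorphism with `p(a, w) = e(a, b(w))`; for `n = 0` (`ℤ/0ℤ = ℤ`) both injectivities
force `A_n = A^∨_n = 0` (`addMonoidHom_zmod_zero_eq_zero`).  Print: «determines a homomorphism `b_{Φ_n,δ_n}`» (2010 rev. p. 430).
[cite: Lan2013PELCompactifications, Lem. 6.2.3.1 (p. 385; 2010 rev. p. 430)] -/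
theorem Lan2013_6231_pairingDeterminesHom_holds {n : ℕ} : Lan2013_6231_pairingDeterminesHom n := by
  intro An Adn W _ _ _ _ _ e hAn hAdn he hef p
  -- Step 1 (counting): `e.flip : A^∨_n → Hom(A_n, ℤ/nℤ)` is bijective.
  have hbij : Function.Bijective e.flip := by
    refine ⟨hef, ?_⟩
    rcases Nat.eq_zero_or_pos n with rfl | hn
    · intro f
      refine ⟨0, ?_⟩
      rw [map_zero, addMonoidHom_zmod_zero_eq_zero f]
    · haveI : NeZero n := NeZero.of_pos hn
      haveI : Finite (An →+ ZMod n) := Finite.of_injective _ DFunLike.coe_injective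
      haveI : Finite (Adn →+ ZMod n) := Finite.of_injective _ DFunLike.coe_injective
      refine ((Nat.bijective_iff_injective_and_card e.flip).2 ⟨hef, le_antisymm ?_ ?_⟩).2
      · exact Nat.card_le_card_of_injective e.flip hef
      · rw [card_addMonoidHom_zmod hAn, ← card_addMonoidHom_zmod hAdn]
        exact Nat.card_le_card_of_injective e he
  -- Step 2: `b := (e.flip)⁻¹ ∘ p.flip` is the unique solution.
  let E := AddEquiv.ofBijective e.flip hbij
  have key : ∀ b : W →+ Adn, (∀ (a : An) (w : W), p a w = e a (b w)) ↔ ∀ w, e.flip (b w) = p.flip w := by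
    intro b
    constructor
    · intro h w
      ext a
      exact (h a w).symm
    · intro h a w
      exact (DFunLike.congr_fun (h w) a).symm
  refine ⟨(E.symm : (An →+ ZMod n) →+ Adn).comp p.flip, (key _).2 fun w => ?_, fun b hb => ?_⟩
  · exact E.apply_symm_apply (p.flip w)
  · ext w
    have hw := (key b).1 hb w
    change b w = E.symm (p.flip w)
    rw [AddEquiv.eq_symm_apply]
    exact hw

end PairingDeterminesHom

end Literature.AlgebraicGeometry.ModuliOfAbelianVarieties.Lan2013.Sec623BoundaryChartsLevelN
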